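import Mathlib
import Literature.Computability.Complexity.RandomKSatEnsembleOGP
import Summits.PneNP.PneNP.Theorems.OverlapGapAlgebraNoStableSectionDefs
import Summits.PneNP.PneNP.Theorems.OverlapGapAlgebraNoStableSectionEnergy
import Summits.PneNP.PneNP.Theorems.OverlapGapAlgebraSearchHardWindowMoatTransfer

/-!
# Route OverlapGapAlgebra, crux `SearchHardWindow` (stmt-PneNP-2460), line `Sketch`:
# stub `stub_bandEnergy` (the OGP band gives energy — Bresler–Huang Prop. 5.2 with `s` darts)

For a tuple `Y 0, …, Y k : Fin n → Bool` in the OGP band — every conditional overlap entropy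
`overlapCondEnt (seqOf Y) ℓ`, `1 ≤ ℓ ≤ k`, is at least `b ≥ 2θ` (`0 < θ < 1`) — the first-appearance
sum with `s` darts,
`FA_s(Y) = Σ_{ℓ ≤ k} #{I : Fin s → Fin n | the pattern r ↦ Y ℓ (I r) differs from r ↦ Y ℓ' (I r) for
every ℓ' < ℓ}`,
is at least `n^s (1 + k (1 − SB_s(p₀)) − θ k(k+1)/2)`, where `SB_s(p) = 2(1−p)^s + s p (1−p)^(s−1)`
and `p₀ = (b − 2θ)/(−log θ)` (Bresler–Huang, arXiv:2106.02129, Prop. 5.2, in DartGame form).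

Proof.  The per-rung bound is the DartGame lemma `en_rung` (its implicit dart count taken to be `s`),
applied to the rung-`0`-normalised sequence `Y' j i = seqOf Y j i ⊕ seqOf Y 0 i`, whose ordered
conditional type entropy `condEnt Y' ℓ` is `overlapCondEnt (seqOf Y) ℓ` by definition
(`mtr_overlapCondEnt_eq_condEnt`).  A dart tuple whose rung-`ℓ` pattern under `Y'` differs from all
earlier patterns under `Y'` also has this property under `Y` (normalising by the same rung-`0` bits
preserves pattern equality), so `en_rung`'s first-appearance set at rung `ℓ = j + 1` is contained in
the `ℓ`-th summand (`ben_subset`).  The rung-`0` summand is all of `(Fin s → Fin n)`, of size `n^s`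
(`ben_card_zero`), and the per-rung bounds `n^s (1 − SB_s(p₀) − (j+1) θ)`, `j < k`, sum to
`n^s (k (1 − SB_s(p₀)) − θ k(k+1)/2)` (`en_sum_fin_linear`).
-/

set_option linter.dupNamespace false -- `Summit.PneNP.PneNP.…`: summit = sub-problem

namespace Summit.PneNP.PneNP.Theorems

open Finset
open Literature.Computability.Complexity
open Summit.PneNP.PneNP.Cruxes.NoStableSection.DartGame
open scoped Classical

/-- The rung-`0` summand of the first-appearance sum: every dart tuple is new at rung `0`, so the
summand is `#(Fin s → Fin n) = n^s`. -/
theorem ben_card_zero (n k s : ℕ) (Y : Fin (k + 1) → Fin n → Bool) :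
    ((univ.filter fun I : Fin s → Fin n =>
        ∀ ℓ' : Fin (k + 1), ℓ' < (0 : Fin (k + 1)) → ¬ ∀ r, Y 0 (I r) = Y ℓ' (I r)).card : ℝ) =
      (n : ℝ) ^ s := by
  rw [Finset.filter_true_of_mem (fun I _ ℓ' h => absurd h (Fin.not_lt_zero ℓ')), card_univ,
    Fintype.card_fun, Fintype.card_fin, Fintype.card_fin]
  push_cast
  ring

/-- At rung `ℓ = j + 1` (`j < k`), `en_rung`'s first-appearance set for the rung-`0`-normalised
sequence `Y' m i = seqOf Y m i ⊕ seqOf Y 0 i` is contained in the `ℓ`-th summand of the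
first-appearance sum of `Y`: if the rung-`ℓ` pattern of a dart tuple under `Y` agrees with its
rung-`ℓ'` pattern for some `ℓ' < ℓ`, the same holds under `Y'`. -/
theorem ben_subset (n k s : ℕ) (Y : Fin (k + 1) → Fin n → Bool) (j : Fin k) :
    (univ.filter fun I : Fin s → Fin n => ∀ ℓ' < (j : ℕ) + 1,
        ¬ ∀ r, (fun (m : ℕ) (i : Fin n) => Bool.xor (seqOf Y m i) (seqOf Y 0 i)) ((j : ℕ) + 1)
            (I r) = (fun (m : ℕ) (i : Fin n) => Bool.xor (seqOf Y m i) (seqOf Y 0 i)) ℓ' (I r)) ⊆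
      univ.filter fun I : Fin s → Fin n =>
        ∀ ℓ' : Fin (k + 1), ℓ' < j.succ → ¬ ∀ r, Y j.succ (I r) = Y ℓ' (I r) := by
  intro I hI
  simp only [Finset.mem_filter, Finset.mem_univ, true_and] at hI ⊢
  intro ℓ' hℓ' hall
  have hlt : (ℓ' : ℕ) < (j : ℕ) + 1 := by
    have h := Fin.lt_def.mp hℓ'
    simpa using h
  have h1 : seqOf Y ((j : ℕ) + 1) = Y j.succ := by
    have h := seqOf_apply_fin Y j.succ
    simpa using h
  refine hI ℓ' hlt fun r => ?_
  rw [h1, seqOf_apply_fin Y ℓ', hall r]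

/-- **Stub E — the OGP band gives energy** (registered as `stub_bandEnergy` in line `Sketch` of crux
`SearchHardWindow`): for a tuple `Y 0, …, Y k` whose conditional overlap entropies at rungs
`1, …, k` are all `≥ b ≥ 2θ` (`0 < θ < 1`), the first-appearance sum with `s` darts is at least
`n^s (1 + k (1 − SB_s(p₀)) − θ k(k+1)/2)`, `SB_s(p) = 2(1−p)^s + s p (1−p)^(s−1)`,
`p₀ = (b − 2θ)/(−log θ)` — Bresler–Huang Prop. 5.2 via the DartGame per-rung bound `en_rung` for
the rung-`0`-normalised sequence, summed over the rungs (`en_sum_fin_linear`). -/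
theorem stub_bandEnergy (n k s : ℕ) (hn : 1 ≤ n) (Y : Fin (k + 1) → Fin n → Bool) (θ b : ℝ)
    (hθ : 0 < θ) (hθ1 : θ < 1) (hb : 2 * θ ≤ b)
    (hband : ∀ ℓ : ℕ, 1 ≤ ℓ → ℓ ≤ k → b ≤ overlapCondEnt (seqOf Y) ℓ) :
    (n : ℝ) ^ s * ((1 : ℝ) + k * (1 - (2 * (1 - (b - 2 * θ) / (-Real.log θ)) ^ s + s * ((b - 2 * θ) / (-Real.log θ)) * (1 - (b - 2 * θ) / (-Real.log θ)) ^ (s - 1))) - θ * ((k : ℝ) * (k + 1) / 2)) ≤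
      (∑ ℓ : Fin (k + 1), ((univ.filter fun I : Fin s → Fin n =>
              ∀ ℓ' : Fin (k + 1), ℓ' < ℓ → ¬ ∀ r, Y ℓ (I r) = Y ℓ' (I r)).card : ℝ)) := by
  -- the band, read as ordered conditional type entropies of the normalised sequence
  have hcond : ∀ ℓ : ℕ, 1 ≤ ℓ → ℓ ≤ k →
      b ≤ condEnt (fun (m : ℕ) (i : Fin n) => Bool.xor (seqOf Y m i) (seqOf Y 0 i)) ℓ := by
    intro ℓ h1 h2
    rw [← mtr_overlapCondEnt_eq_condEnt]
    exact hband ℓ h1 h2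
  set A : ℝ := 2 * (1 - (b - 2 * θ) / (-Real.log θ)) ^ s +
    s * ((b - 2 * θ) / (-Real.log θ)) * (1 - (b - 2 * θ) / (-Real.log θ)) ^ (s - 1) with hA
  -- the per-rung bounds at `ℓ = j + 1`, `j < k`, summed
  have hsum : ∑ j : Fin k, (n : ℝ) ^ s * (1 - A - (((j : ℕ) + 1 : ℕ) : ℝ) * θ) ≤
      ∑ j : Fin k, ((univ.filter fun I : Fin s → Fin n =>
        ∀ ℓ' : Fin (k + 1), ℓ' < j.succ → ¬ ∀ r, Y j.succ (I r) = Y ℓ' (I r)).card : ℝ) := by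
    refine Finset.sum_le_sum fun j _ => ?_
    refine (en_rung (k := s) (fun (m : ℕ) (i : Fin n) => Bool.xor (seqOf Y m i) (seqOf Y 0 i))
      ((j : ℕ) + 1) hn hθ hθ1 hb (hcond _ (by omega) (by omega))).trans ?_
    exact_mod_cast Finset.card_le_card (ben_subset n k s Y j)
  rw [← Finset.mul_sum, en_sum_fin_linear] at hsum
  -- the rung-`0` summand
  have h0 := ben_card_zero n k s Y
  rw [Fin.sum_univ_succ]
  calc (n : ℝ) ^ s * (1 + k * (1 - A) - θ * ((k : ℝ) * (k + 1) / 2))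
      = (n : ℝ) ^ s + (n : ℝ) ^ s * (k * (1 - A) - θ * ((k : ℝ) * (k + 1) / 2)) := by ring
    _ ≤ _ := by linarith

end Summit.PneNP.PneNP.Theorems
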